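import Mathlib
import HarnessLib
import Summits.Ventures.LatticeQCDFlow.Scaling.TorusTopLinkComb

/-!
# LatticeQCDFlow / Scaling — a ranked plaquette structure of `(ℤ/L)^d` in EVERY dimension from the
# acyclic product matching of the `d`-fold product of cycles (discrete Morse theory of the torus)

HONEST FRAMING: exact (Metropolis-corrected) sampling algorithms for lattice gauge theory;
figures of merit are autocorrelation/cost numbers at stated couplings and volumes; no
continuum-physics claim.

Venture `LatticeQCDFlow` (cell pub-lqcd), topic `Scaling`, FANOUT row 30 (lean-1, GEN-25) — OUR WORK on
THEORY-2.md §4 row C5.  A collection `B` of plaquettes of `(ℤ/L)^d` RANKED for a top-link assignment `t`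
(`t p` a link of `p`; `rank p < rank p'` whenever `t p` lies on another `p' ∈ B`) carries an exact
one-plaquette heat-bath autoregression (`Scaling/AutoregressiveGaugeHeatBathRanked`), and
`TorusRankedHomologyBound` shows `#B ≤ #links − #sites + 1 − d = (d−1)(L^d − 1)` for every ranked `B`.
THIS FILE gives a ranked structure in EVERY dimension `d` (sequel `TorusRankedMorseCount`: it has exactly
`(d−1)(L^d − 1)` plaquettes, so the homology bound is attained and
`k_min(d) = (d−1)(d−2)/2·L^d + (d−1)` exactly).  It is the set of plaquettes matched downwards by the
PRODUCT of the perfect acyclic matchings of the cycle `C_L` (vertex `c ↔` edge `(c−1, c)` for `c ≠ 0`;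
critical cells: the vertex `0` and the edge `(−1, 0)`), acting on the first non-critical coordinate:

* `B` = plaquettes `(x; i < j)` with `x_m = 0` for all `m < i` and EITHER `x_i ≠ −1` (then
  `t = (x + e_i, j)`) OR `x_m = 0` for `i < m < j` and `x_j ≠ −1` (then, if `x_i = −1`, `t = (x + e_j, i)`);
* `rank (x; i, j) = 4·Σ_m x_m.val + [x_i = −1 ? 4 : 3] + [x_j = −1 ? 4 : 3]` — twice the sum of the
  one-dimensional discrete Morse values (vertex `c ↦ 2c`, edge `(c, c+1) ↦ 2c + 3/2`, critical edge
  `(−1, 0) ↦ 2L`), which decreases along every gradient path of the product matching.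

Results: **`morse_mem_links`** (the assignment picks a link of its plaquette), **`morse_rank_lt`** (THE
STRUCTURE IS RANKED, `L ≥ 2`: eight incidence cases — the plaquettes through `t p` other than `p` are
either outside `B` or one Morse step up), and the general lemma **`injOn_of_ranked`** (a ranked top-link
assignment is automatically injective on `B`), whence `morse_injOn`.

No `def` (the structure is passed as hypotheses `hB`, `ht`, `hr` fixing `B`, `t`, `rank` to explicit
terms), no `sorry`, nothing cited as a fact beyond the tree.
-/

namespace Summit.Ventures.LatticeQCDFlow.Theory2.Autoregressive

open Finset
open Literature.MathematicalPhysics.QuantumFieldTheory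

variable {d L : ℕ} [NeZero L]

/-! ## §1 A ranked top-link assignment is injective -/

omit [NeZero L] in
/-- **A ranked top-link assignment is injective on its collection**: if `t p = t p'` for `p ≠ p'` in `B`,
then `t p` lies on `p'` and `t p'` lies on `p`, so `rank p < rank p' < rank p`. [ours] -/
theorem injOn_of_ranked (B : Finset (Plaquette d L)) (t : Plaquette d L → Edge d L)
    (ht : ∀ p ∈ B, t p ∈ ({(p.1, p.2.1.1), (p.1.shift p.2.1.1, p.2.1.2),
        (p.1.shift p.2.1.2, p.2.1.1), (p.1, p.2.1.2)} : Finset (Edge d L)))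
    (rank : Plaquette d L → ℕ)
    (hrank : ∀ p ∈ B, ∀ p' ∈ B, p ≠ p' → t p ∈ ({(p'.1, p'.2.1.1), (p'.1.shift p'.2.1.1, p'.2.1.2),
        (p'.1.shift p'.2.1.2, p'.2.1.1), (p'.1, p'.2.1.2)} : Finset (Edge d L)) → rank p < rank p') :
    Set.InjOn t B := by
  intro p hp p' hp' heq
  by_contra hne
  have h1 : rank p < rank p' := hrank p hp p' hp' hne (heq ▸ ht p' hp')
  have h2 : rank p' < rank p := hrank p' hp' p hp (Ne.symm hne) (heq ▸ ht p hp)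
  omega

/-! ## §2 The assignment picks a link of its plaquette -/

omit [NeZero L] in
/-- **The Morse assignment picks a link of its plaquette**: `(x + e_j, i)` or `(x + e_i, j)`. [ours] -/
theorem morse_mem_links (t : Plaquette d L → Edge d L)
    (ht : t = fun p => if p.1 p.2.1.1 = -1 then (p.1.shift p.2.1.2, p.2.1.1) else (p.1.shift p.2.1.1, p.2.1.2))
    (p : Plaquette d L) :
    t p ∈ ({(p.1, p.2.1.1), (p.1.shift p.2.1.1, p.2.1.2), (p.1.shift p.2.1.2, p.2.1.1), (p.1, p.2.1.2)} :
      Finset (Edge d L)) := by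
  subst ht
  simp only
  split_ifs <;> simp

/-! ## §3 The structure is ranked -/

/-- **THE MORSE STRUCTURE IS RANKED.**  `L ≥ 2`.  For `p ≠ p'` in `B` with `t p` a link of `p'`,
`rank p < rank p'`: writing `p = (x; i, j)`, the plaquettes through `t p = (x + e_i, j)` (case `x_i ≠ −1`) or
`(x + e_j, i)` (case `x_i = −1`) other than `p` are either outside `B` (their first non-critical coordinate
is a vertex, or a required zero ∕ non-`−1` fails) or obtained from `p` by one more unit in direction `i`
(resp. `j`) or by trading an edge for an earlier one — each raising `4·Σ_m x_m.val + corrections` by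
`4` or `5`. [ours] -/
theorem morse_rank_lt (hL : 2 ≤ L) (B : Finset (Plaquette d L)) (t : Plaquette d L → Edge d L)
    (rank : Plaquette d L → ℕ)
    (hB : B = Finset.univ.filter (fun p : Plaquette d L =>
      (∀ m : Fin d, m < p.2.1.1 → p.1 m = 0) ∧
        (p.1 p.2.1.1 ≠ -1 ∨ ((∀ m : Fin d, p.2.1.1 < m → m < p.2.1.2 → p.1 m = 0) ∧ p.1 p.2.1.2 ≠ -1))))
    (ht : t = fun p => if p.1 p.2.1.1 = -1 then (p.1.shift p.2.1.2, p.2.1.1) else (p.1.shift p.2.1.1, p.2.1.2))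
    (hr : rank = fun p => 4 * ∑ m, (p.1 m).val + (if p.1 p.2.1.1 = -1 then 4 else 3) +
      (if p.1 p.2.1.2 = -1 then 4 else 3)) :
    ∀ p ∈ B, ∀ p' ∈ B, p ≠ p' →
      t p ∈ ({(p'.1, p'.2.1.1), (p'.1.shift p'.2.1.1, p'.2.1.2), (p'.1.shift p'.2.1.2, p'.2.1.1),
        (p'.1, p'.2.1.2)} : Finset (Edge d L)) → rank p < rank p' := by
  haveI : Fact (1 < L) := ⟨hL⟩
  subst ht; subst hB; subst hr
  -- coordinate bookkeeping
  have hsame : ∀ (y : Site d L) (i : Fin d), (y.shift i) i = y i + 1 := by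
    intro y i; simp [Site.shift]
  have hne' : ∀ (y : Site d L) (i m : Fin d), m ≠ i → (y.shift i) m = y m := by
    intro y i m h; simp [Site.shift, h]
  have hinj : ∀ (y z : Site d L) (i : Fin d), y.shift i = z.shift i → y = z := by
    intro y z i h; simpa [Site.shift] using h
  have hcross : ∀ (y z : Site d L) (a b : Fin d), a ≠ b → y.shift a = z.shift b →
      y a + 1 = z a ∧ y b = z b + 1 ∧ ∀ m, m ≠ a → m ≠ b → y m = z m := by
    intro y z a b hab h
    have hm := fun m => congrFun h m
    simp only [Site.shift, Pi.add_apply] at hm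
    refine ⟨?_, ?_, ?_⟩
    · have := hm a
      rwa [Pi.single_eq_same, Pi.single_eq_of_ne hab, add_zero] at this
    · have := hm b
      rwa [Pi.single_eq_same, Pi.single_eq_of_ne (Ne.symm hab), add_zero] at this
    · intro m hma hmb
      have := hm m
      rwa [Pi.single_eq_of_ne hma, Pi.single_eq_of_ne hmb, add_zero, add_zero] at this
  have hval : ∀ z : ZMod L, z ≠ -1 → (z + 1).val = z.val + 1 := fun z hz => val_add_one_of_ne_neg_one hL hz
  have hm1 : ∀ z : ZMod L, z ≠ -1 → z + 1 ≠ 0 := fun z hz h => hz (eq_neg_of_add_eq_zero_left h)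
  have h0m1 : (0 : ZMod L) ≠ -1 := fun h => (neg_ne_zero.mpr (one_ne_zero (α := ZMod L))) h.symm
  have hm1z : ∀ z : ZMod L, z + 1 = 0 → z = -1 := fun z h => eq_neg_of_add_eq_zero_left h
  have hS : ∀ (y : Site d L) (i : Fin d), y i ≠ -1 →
      ∑ m, ((y.shift i) m).val = ∑ m, (y m).val + 1 := by
    intro y i hy
    have hpt : ∀ m, ((y.shift i) m).val = (y m).val + if m = i then 1 else 0 := by
      intro m
      by_cases hm : m = i
      · rw [hm, if_pos rfl, hsame, hval _ hy]
      · rw [if_neg hm, hne' y i m hm, add_zero]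
    simp_rw [hpt]
    rw [Finset.sum_add_distrib]
    simp
  intro p hp p' hp' hne hmem
  obtain ⟨x, ⟨⟨i, j⟩, hij⟩⟩ := p
  obtain ⟨x', ⟨⟨i', j'⟩, hij'⟩⟩ := p'
  simp only [mem_filter, mem_univ, true_and] at hp hp'
  simp only at hij hij' hmem ⊢
  obtain ⟨hpre, hp2⟩ := hp
  obtain ⟨hpre', hp2'⟩ := hp'
  have hij0 : i ≠ j := ne_of_lt hij
  have hij0' : i' ≠ j' := ne_of_lt hij'
  by_cases hxi : x i = -1
  · -- case `x_i = −1`: `t p = (x + e_j, i)`, and `x_m = 0` for `i < m < j`, `x_j ≠ −1`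
    rw [if_pos hxi] at hmem
    have hB2 : (∀ m : Fin d, i < m → m < j → x m = 0) ∧ x j ≠ -1 := by
      rcases hp2 with h | h
      · exact absurd hxi h
      · exact h
    obtain ⟨hmid, hxj⟩ := hB2
    simp only [Finset.mem_insert, Finset.mem_singleton, Prod.mk.injEq] at hmem
    rcases hmem with ⟨hx, hidx⟩ | ⟨hx, hidx⟩ | ⟨hx, hidx⟩ | ⟨hx, hidx⟩
    · -- (b1) `t p = (x', i')`: `x' = x + e_j`, `i' = i`
      subst hidx; subst hx
      rw [hne' x j i hij0] at hp2'
      rcases hp2' with h | ⟨hmid', hxj'⟩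
      · exact absurd hxi h
      rcases lt_trichotomy j' j with hlt | heq | hgt
      · have e1 : (x.shift j) j' = 0 := by rw [hne' x j j' (ne_of_lt hlt)]; exact hmid j' hij' hlt
        simp only [hne' x j i hij0, e1, hxi, hxj, h0m1, if_true, if_false, hS x j hxj]
        omega
      · subst heq
        simp only [hne' x j' i hij0, hsame, hxi, hxj, if_true, if_false, hS x j' hxj]
        split_ifs <;> omega
      · exact absurd (hmid' j hij hgt) (by rw [hsame]; exact hm1 _ hxj)
    · -- (b2) `t p = (x' + e_{i'}, j')`: `j' = i`, `i' < i`
      subst hidx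
      have hi'j : i' ≠ j := fun h => by rw [h] at hij'; exact lt_asymm hij hij'
      obtain ⟨h1, h2, h3⟩ := hcross x x' j i' (Ne.symm hi'j) hx
      have hx'i' : x' i' = -1 := hm1z _ (by rw [← h2]; exact hpre i' hij')
      rcases hp2' with h | ⟨hmid', hx'i⟩
      · exact absurd hx'i' h
      · have : x' i = x i := (h3 i hij0 (ne_of_lt hij').symm).symm
        exact absurd (this.trans hxi) hx'i
    · -- (b3) `t p = (x' + e_{j'}, i')`: `i' = i`
      subst hidx
      by_cases hjj : j' = j
      · subst hjj
        have hxx : x = x' := hinj x x' j' hx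
        subst hxx
        exact absurd rfl hne
      · obtain ⟨h1, h2, h3⟩ := hcross x x' j j' (Ne.symm hjj) hx
        rcases hp2' with h | ⟨hmid', hxj'⟩
        · exact absurd ((h3 i hij0 hij0').symm.trans hxi) h
        rcases lt_or_gt_of_ne hjj with hlt | hgt
        · have : x' j' = -1 := hm1z _ (by rw [← h2]; exact hmid j' hij' hlt)
          exact absurd this hxj'
        · have : x' j = 0 := hmid' j hij hgt
          exact absurd this (by rw [← h1]; exact hm1 _ hxj)
    · -- (b4) `t p = (x', j')`: `x' = x + e_j`, `j' = i`, `i' < i`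
      subst hidx; subst hx
      have hi'j : i' ≠ j := fun h => by rw [h] at hij'; exact lt_asymm hij hij'
      have e1 : (x.shift j) i' = 0 := by rw [hne' x j i' hi'j]; exact hpre i' hij'
      simp only [e1, hne' x j i hij0, hxi, hxj, h0m1, if_true, if_false, hS x j hxj]
      omega
  · -- case `x_i ≠ −1`: `t p = (x + e_i, j)`
    rw [if_neg hxi] at hmem
    simp only [Finset.mem_insert, Finset.mem_singleton, Prod.mk.injEq] at hmem
    rcases hmem with ⟨hx, hidx⟩ | ⟨hx, hidx⟩ | ⟨hx, hidx⟩ | ⟨hx, hidx⟩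
    · -- (a1) `t p = (x', i')`: `x' = x + e_i`, `i' = j`: position `i < j = i'` of `x'` is non-zero
      subst hidx; subst hx
      exact absurd (hpre' i hij) (by rw [hsame]; exact hm1 _ hxi)
    · -- (a2) `t p = (x' + e_{i'}, j')`: `j' = j`
      subst hidx
      by_cases hii : i' = i
      · subst hii
        have hxx : x = x' := hinj x x' i' hx
        subst hxx
        exact absurd rfl hne
      · obtain ⟨h1, h2, h3⟩ := hcross x x' i i' (Ne.symm hii) hx
        rcases lt_or_gt_of_ne hii with hlt | hgt
        · -- `i' < i`: `x' i' = −1` and `x' i ≠ 0` between `i'` and `j`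
          have hx'i' : x' i' = -1 := hm1z _ (by rw [← h2]; exact hpre i' hlt)
          rcases hp2' with h | ⟨hmid', -⟩
          · exact absurd hx'i' h
          · exact absurd (hmid' i hlt hij) (by rw [← h1]; exact hm1 _ hxi)
        · exact absurd (hpre' i hgt) (by rw [← h1]; exact hm1 _ hxi)
    · -- (a3) `t p = (x' + e_{j'}, i')`: `i' = j`, so `i < j = i' < j'`
      subst hidx
      have hij'' : i ≠ j' := ne_of_lt (hij.trans hij')
      obtain ⟨h1, h2, h3⟩ := hcross x x' i j' hij'' hx
      exact absurd (hpre' i hij) (by rw [← h1]; exact hm1 _ hxi)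
    · -- (a4) `t p = (x', j')`: `x' = x + e_i`, `j' = j`
      subst hidx; subst hx
      rcases lt_trichotomy i' i with hlt | heq | hgt
      · have e1 : (x.shift i) i' = 0 := by rw [hne' x i i' (ne_of_lt hlt)]; exact hpre i' hlt
        simp only [e1, hne' x i j (Ne.symm hij0), hxi, h0m1, if_false, hS x i hxi]
        omega
      · subst heq
        simp only [hsame, hne' x i' j (Ne.symm hij0), hxi, if_false, hS x i' hxi]
        split_ifs <;> omega
      · exact absurd (hpre' i hgt) (by rw [hsame]; exact hm1 _ hxi)

/-- **The Morse assignment is injective on the Morse structure** (`L ≥ 2`). [ours] -/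
theorem morse_injOn (hL : 2 ≤ L) (B : Finset (Plaquette d L)) (t : Plaquette d L → Edge d L)
    (hB : B = Finset.univ.filter (fun p : Plaquette d L =>
      (∀ m : Fin d, m < p.2.1.1 → p.1 m = 0) ∧
        (p.1 p.2.1.1 ≠ -1 ∨ ((∀ m : Fin d, p.2.1.1 < m → m < p.2.1.2 → p.1 m = 0) ∧ p.1 p.2.1.2 ≠ -1))))
    (ht : t = fun p => if p.1 p.2.1.1 = -1 then (p.1.shift p.2.1.2, p.2.1.1) else (p.1.shift p.2.1.1, p.2.1.2)) :
    Set.InjOn t B :=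
  injOn_of_ranked B t (fun p _ => morse_mem_links t ht p) _ (morse_rank_lt hL B t _ hB ht rfl)

end Summit.Ventures.LatticeQCDFlow.Theory2.Autoregressive
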